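import Literature.Probability.LatticeModels.CurrentPartitionMonotone
import HarnessLib

/-!
# Griffiths monotonicity of the restricted correlations `⟨σ_A⟩_{Λ∖T}` in the deleted set

Topic `Literature/Probability/LatticeModels`. For edge couplings `K ≥ 0` on a finite simple graph `G`
and the `ℝ≥0∞` current sums `Z_{G∖T}[A] = ecurrentSumIn (offGraph G T) K A` of the graph with the edges
meeting the vertex set `T` deleted (`WeightedCurrents.lean`; `Z_{G∖T}[A]/Z_{G∖T}[∅] = ⟨σ_A⟩_{Λ∖T}` is the
correlation of the restricted state), this file proves **Griffiths' second inequality in the form used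
throughout Aizenman–Duminil-Copin 2021, Appendix A** ("a trivial application of Griffiths' inequality
[Gri67]": the restricted correlation `⟨σ_B⟩_{Λ∖C}` only decreases when the deleted set grows):

* `wcurrentSum_mul_le_of_le` — `0 ≤ K' ≤ K ⇒ Z_{K'}[A] Z_K[∅] ≤ Z_K[A] Z_{K'}[∅]` (real current sums),
  i.e. `⟨σ_A⟩_{K'} ≤ ⟨σ_A⟩_K`, from the tree's Griffiths comparison inequality
  `gksExpect_mono_of_abs_le` (`GKSInequalities.lean`, Friedli–Velenik Thm. 3.49 / Exercise 3.31) and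
  the Ising dictionary `∑_σ σ_A ∏_e e^{K_e σ_e} = 2^{|V|} Z_K[A]` (`WeightedCurrentsDictionary.lean`);
* `ecurrentSumIn_offGraph_mul_le_of_subset` — for `T ⊆ T'` and every `A`,
  `Z_{G∖T'}[A] · Z_{G∖T}[∅] ≤ Z_{G∖T}[A] · Z_{G∖T'}[∅]`, i.e. `⟨σ_A⟩_{Λ∖T'} ≤ ⟨σ_A⟩_{Λ∖T}`
  (deleting edges = cutting couplings, `ecurrentSumIn_offGraph_eq_cutCoupling` of
  `CurrentPartitionMonotone.lean`);
* `ecurrentSumIn_offGraph_mul_ecurrentSum_empty_le` — the case `T = ∅` of the smaller set: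
  `Z_{G∖T}[A] · Z[∅] ≤ Z[A] · Z_{G∖T}[∅]` (`⟨σ_A⟩_{Λ∖T} ≤ ⟨σ_A⟩_Λ`), the inequality
  `E^{A,B}[F] ≤ E^{A,∅}[F]` of ADC Lemma A.1 for general `B` and the input of ADC Corollary A.2.

No named fact is introduced; everything is proved.

## References

* M. Aizenman, H. Duminil-Copin, Ann. of Math. 194 (2021), arXiv:1912.07973, Appendix A.1 (Lemma A.1,
  Corollary A.2: "Griffiths' inequality [Gri67]") [AizenmanDuminilCopinAnnals2021].
* R. B. Griffiths, J. Math. Phys. 8 (1967); D. G. Kelly, S. Sherman, J. Math. Phys. 9 (1968)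
  [KellySherman1968]; S. Friedli, Y. Velenik, CUP 2017, Thm. 3.49 and Exercise 3.31 [FriedliVelenik2017]
  — through `GKSInequalities.lean` and `CurrentPartitionMonotone.lean`.
-/

noncomputable section

open Finset
open scoped symmDiff ENNReal

namespace Literature.Probability.LatticeModels

variable {V : Type*} [Fintype V] [DecidableEq V] {G : SimpleGraph V} [DecidableRel G.Adj]

/-- **The dictionary for correlations**: `∑_ω ω_A ∏_e exp(K_e ω_e) = 2^{|V|} Z_K[A]` in `gksSum` form
(`K ≥ 0`). [cite: Panis2023Triviality, §4.1] -/
theorem gksSum_edgeEnds_spinProduct_eq {K : G.edgeFinset → ℝ} (hK : ∀ e, 0 ≤ K e) (A : Finset V) :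
    gksSum univ K edgeEnds (spinProduct A) = (2 : ℝ) ^ Fintype.card V * wcurrentSum K A := by
  rw [← sum_spinProduct_mul_prod_exp_eq hK A]
  simp only [gksSum, gksWeight_edgeEnds]

/-- **Griffiths' comparison inequality for current sums** (GKS II): for couplings `0 ≤ K' ≤ K` and every
`A`, `Z_{K'}[A] · Z_K[∅] ≤ Z_K[A] · Z_{K'}[∅]`, i.e. `⟨σ_A⟩_{K'} ≤ ⟨σ_A⟩_K`.
[cite: FriedliVelenik2017, Thm. 3.49 and Exercise 3.31] -/
theorem wcurrentSum_mul_le_of_le {K K' : G.edgeFinset → ℝ} (hK' : ∀ e, 0 ≤ K' e) (hle : ∀ e, K' e ≤ K e)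
    (A : Finset V) : wcurrentSum K' A * wcurrentSum K ∅ ≤ wcurrentSum K A * wcurrentSum K' ∅ := by
  have hK : ∀ e, 0 ≤ K e := fun e => (hK' e).trans (hle e)
  have h := gksExpect_mono_of_abs_le (s := univ) (C := edgeEnds) (K := K) (K' := K')
    (fun e _ => by rw [abs_of_nonneg (hK' e)]; exact hle e) A
  rw [gksExpect, gksExpect, div_le_div_iff₀ (gksSum_one_pos _ _ _) (gksSum_one_pos _ _ _),
    gksSum_edgeEnds_spinProduct_eq hK', gksSum_edgeEnds_spinProduct_eq hK, gksSum_edgeEnds_one_eq hK,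
    gksSum_edgeEnds_one_eq hK'] at h
  have hpow : (0 : ℝ) < (2 : ℝ) ^ Fintype.card V := by positivity
  have h' : (2 : ℝ) ^ Fintype.card V * (2 : ℝ) ^ Fintype.card V * (wcurrentSum K' A * wcurrentSum K ∅) ≤
      (2 : ℝ) ^ Fintype.card V * (2 : ℝ) ^ Fintype.card V * (wcurrentSum K A * wcurrentSum K' ∅) := by
    calc _ = (2 : ℝ) ^ Fintype.card V * wcurrentSum K' A * ((2 : ℝ) ^ Fintype.card V * wcurrentSum K ∅) := by
          ring
      _ ≤ (2 : ℝ) ^ Fintype.card V * wcurrentSum K A * ((2 : ℝ) ^ Fintype.card V * wcurrentSum K' ∅) := h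
      _ = _ := by ring
  exact le_of_mul_le_mul_left h' (mul_pos hpow hpow)

/-- Cutting off at a larger vertex set gives smaller couplings: `T ⊆ T'`, `K ≥ 0` imply
`cutCoupling K T' ≤ cutCoupling K T`. [folklore] -/
theorem cutCoupling_le_of_subset {K : G.edgeFinset → ℝ} (hK : ∀ e, 0 ≤ K e) {T T' : Finset V} (h : T ⊆ T')
    (e : G.edgeFinset) : cutCoupling K T' e ≤ cutCoupling K T e := by
  unfold cutCoupling
  by_cases h' : Current.EdgeOff T' (e : Sym2 V)
  · have hT : Current.EdgeOff T (e : Sym2 V) := fun v hv hvT => h' v hv (h hvT)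
    rw [if_pos h', if_pos hT]
  · rw [if_neg h']
    split_ifs
    · exact hK e
    · exact le_rfl

/-- **Griffiths monotonicity of the restricted correlations in the deleted set**: for `K ≥ 0`, `T ⊆ T'`
and every `A`, `Z_{G∖T'}[A] · Z_{G∖T}[∅] ≤ Z_{G∖T}[A] · Z_{G∖T'}[∅]`, i.e.
`⟨σ_A⟩_{Λ∖T'} ≤ ⟨σ_A⟩_{Λ∖T}` (Aizenman–Duminil-Copin 2021, proof of Cor. A.2: "Griffiths' inequality
[Gri67], and the trivial inclusion `C_{n₁+n₂}(x) ⊂ 𝐂`"). [cite: AizenmanDuminilCopinAnnals2021, arXiv:1912.07973 Appendix A.1, Corollary A.2, proof] -/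
theorem ecurrentSumIn_offGraph_mul_le_of_subset {K : G.edgeFinset → ℝ} (hK : ∀ e, 0 ≤ K e)
    {T T' : Finset V} (h : T ⊆ T') (A : Finset V) :
    ecurrentSumIn (offGraph G T') K A * ecurrentSumIn (offGraph G T) K ∅ ≤
      ecurrentSumIn (offGraph G T) K A * ecurrentSumIn (offGraph G T') K ∅ := by
  rw [ecurrentSumIn_offGraph_eq_cutCoupling, ecurrentSumIn_offGraph_eq_cutCoupling,
    ecurrentSumIn_offGraph_eq_cutCoupling, ecurrentSumIn_offGraph_eq_cutCoupling,
    ecurrentSum_eq_ofReal (cutCoupling_nonneg hK T'), ecurrentSum_eq_ofReal (cutCoupling_nonneg hK T),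
    ecurrentSum_eq_ofReal (cutCoupling_nonneg hK T), ecurrentSum_eq_ofReal (cutCoupling_nonneg hK T'),
    ← ENNReal.ofReal_mul (wcurrentSum_nonneg (cutCoupling_nonneg hK T') A),
    ← ENNReal.ofReal_mul (wcurrentSum_nonneg (cutCoupling_nonneg hK T) A)]
  exact ENNReal.ofReal_le_ofReal
    (wcurrentSum_mul_le_of_le (cutCoupling_nonneg hK T') (cutCoupling_le_of_subset hK h) A)

/-- Deleting no edge: `Z_{G∖∅}[A] = Z[A]`. [folklore] -/
theorem ecurrentSumIn_offGraph_empty_eq (K : G.edgeFinset → ℝ) (A : Finset V) :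
    ecurrentSumIn (offGraph G (∅ : Finset V)) K A = ecurrentSum K A := by
  unfold ecurrentSumIn ecurrentSum
  refine tsum_congr fun n => ?_
  have hs : Current.IsSupp (offGraph G (∅ : Finset V)) n :=
    isSupp_offGraph_iff.2 fun _ he => absurd (fun v _ => Finset.notMem_empty v) he
  simp [hs]

/-- **Griffiths' inequality for the restricted correlations** (the inequality half of
Aizenman–Duminil-Copin 2021, Lemma A.1, general `B`): for `K ≥ 0`, every `T` and `A`,
`Z_{G∖T}[A] · Z[∅] ≤ Z[A] · Z_{G∖T}[∅]`, i.e. `⟨σ_A⟩_{Λ∖T} ≤ ⟨σ_A⟩_Λ`.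
[cite: AizenmanDuminilCopinAnnals2021, arXiv:1912.07973 Appendix A.1, Lemma A.1] -/
theorem ecurrentSumIn_offGraph_mul_ecurrentSum_empty_le {K : G.edgeFinset → ℝ} (hK : ∀ e, 0 ≤ K e)
    (T A : Finset V) :
    ecurrentSumIn (offGraph G T) K A * ecurrentSum K ∅ ≤ ecurrentSum K A * ecurrentSumIn (offGraph G T) K ∅ := by
  have h := ecurrentSumIn_offGraph_mul_le_of_subset hK (Finset.empty_subset T) A
  rwa [ecurrentSumIn_offGraph_empty_eq, ecurrentSumIn_offGraph_empty_eq] at h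

end Literature.Probability.LatticeModels
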